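import Summits.QuantumAdvantage.QuantumAdvantage.Theorems.CharDialSchedFibreA

/-! # CharDialSchedFibre — part 2/2 (mechanical split for landing of `CharDialSchedFibre`; content verbatim; scopes re-opened with their variables) -/


namespace Summit.QuantumAdvantage.AdviceFreeQNC0
open Finset AffBells22

namespace CounterLaw

section Process
variable {n : ℕ} (p : ℕ) [NeZero p] (y : Fin (n + 1) → (Fin n → Bool) → Bool) (τ : Fin n → Bool × Bool)
  (W : Finset (Fin n)) (b : Fin n → Bool)

/-- the weighted `L_{i₀}`-count of the final state as a weighted mass of the final law. -/
theorem sum_weight_mass_memT (i₀ : Idx) (w : ZMod p → ℝ) :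
    ∑ b', w b' * mass (lawTp p y τ W b n) i₀ b'
      = ∑ u : Fin n → Bool,
          if mem i₀ (XTp p y τ (subcubeMerge W b u) n).1 (XTp p y τ (subcubeMerge W b u) n).2.1 = true
          then w (ctrN p (subcubeMerge W b u) n) else 0 := by
  set F : St p → ℝ := fun x => if mem i₀ x.1 x.2.1 = true then w x.2.2 else 0 with hF
  have h1 : ∀ u : Fin n → Bool,
      (if mem i₀ (XTp p y τ (subcubeMerge W b u) n).1 (XTp p y τ (subcubeMerge W b u) n).2.1 = true
        then w (ctrN p (subcubeMerge W b u) n) else 0) = F (XTp p y τ (subcubeMerge W b u) n) := by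
    intro u; rfl
  simp only [h1]
  rw [← Finset.sum_fiberwise (univ : Finset (Fin n → Bool)) (fun u : Fin n → Bool => XTp p y τ (subcubeMerge W b u) n)
    (fun u : Fin n → Bool => F (XTp p y τ (subcubeMerge W b u) n))]
  have h2 : ∀ x : St p, ∑ u ∈ univ.filter (fun u : Fin n → Bool => XTp p y τ (subcubeMerge W b u) n = x),
      F (XTp p y τ (subcubeMerge W b u) n) = lawTp p y τ W b n x * F x := by
    intro x
    rw [sum_congr rfl fun u hu => by rw [(mem_filter.mp hu).2], sum_const, nsmul_eq_mul]
    rfl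
  simp only [h2]
  rw [sum_St]
  refine sum_congr rfl fun b' _ => ?_
  unfold mass
  rw [mul_sum]
  refine sum_congr rfl fun g _ => ?_
  rw [mul_sum]
  refine sum_congr rfl fun a _ => ?_
  simp only [hF]
  split_ifs <;> ring

/-- **the weighted count**: `Σ_{u ∈ L-event} h_n(W_n(u')) ≥ ⅓·Σ_u h_n(W_n(u')) − 4p·2ⁿ·√(12p/(n − |W| + 1))`. -/
theorem weighted_memT_ge (h3 : ¬ 3 ∣ p) (κ : ZMod 3) (h : ℕ → ZMod p → ℝ)
    (hfree : ∀ t : Fin n, t ∉ W → ∀ b', h t.val b' = (h (t.val + 1) b' + h (t.val + 1) (b' + 1)) / 2)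
    (hfroz : ∀ t : Fin n, t ∈ W → ∀ b', h t.val b' = h (t.val + 1) (b' + (((b t).toNat : ℕ) : ZMod p)))
    (h0 : ∀ t b', 0 ≤ h t b') (h1 : ∀ t b', h t b' ≤ 1) :
    (∑ u : Fin n → Bool, h n (ctrN p (subcubeMerge W b u) n)) / 3
        - 4 * p * (2 : ℝ) ^ n * Real.sqrt (12 * p / ((n - W.card : ℕ) + 1))
      ≤ ∑ u : Fin n → Bool,
          if mem (κ, none) (XTp p y τ (subcubeMerge W b u) n).1 (XTp p y τ (subcubeMerge W b u) n).2.1 = true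
          then h n (ctrN p (subcubeMerge W b u) n) else 0 := by
  have hp : (0 : ℝ) < p := by exact_mod_cast NeZero.pos p
  have hRHS : 0 ≤ ∑ u : Fin n → Bool,
      if mem (κ, none) (XTp p y τ (subcubeMerge W b u) n).1 (XTp p y τ (subcubeMerge W b u) n).2.1 = true
      then h n (ctrN p (subcubeMerge W b u) n) else 0 :=
    sum_nonneg fun u _ => by split_ifs <;> simp [h0]
  have hsum_le : ∑ u : Fin n → Bool, h n (ctrN p (subcubeMerge W b u) n) ≤ (2 : ℝ) ^ n := by
    calc ∑ u : Fin n → Bool, h n (ctrN p (subcubeMerge W b u) n) ≤ ∑ _u : Fin n → Bool, (1 : ℝ) :=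
          sum_le_sum fun u _ => h1 _ _
      _ = (2 : ℝ) ^ n := by simp
  set m := n - W.card with hmdef
  by_cases hmn : 12 * p < m + 1
  · obtain ⟨t, _, hD⟩ := exists_D1T_le_free p y τ W b hmn
    have htn : t.val ≤ n := t.isLt.le
    -- the `L`-mass dominates `Φ^{h_n}(lawTp n) ≥ Φ^{h_t}(lawTp t)`
    have hA : phiW (h t.val) (lawTp p y τ W b t.val) ≤ ∑ u : Fin n → Bool,
        if mem (κ, none) (XTp p y τ (subcubeMerge W b u) n).1 (XTp p y τ (subcubeMerge W b u) n).2.1 = true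
        then h n (ctrN p (subcubeMerge W b u) n) else 0 := by
      rw [← sum_weight_mass_memT p y τ W b (κ, none) (h n)]
      exact (phiW_lawTp_mono p y τ W b h hfree hfroz h0 htn le_rfl).trans (phiW_le_mass_sum (h n) (h0 n) _ _)
    -- two-block + label average at the good free time
    have hB : (∑ u : Fin n → Bool, h n (ctrN p (subcubeMerge W b u) n)) / 3
        - 2 * p * D1T p (τ t) (lawTp p y τ W b t.val) ≤ phiW (h t.val) (lawTp p y τ W b t.val) := by
      rw [← sum_weight_ctrT p W b h hfree hfroz htn le_rfl, ← sum_weight_fib_lawTp p y τ W b (h t.val) t.val]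
      exact phiW_lawTp_ge p y τ W b h3 (τ t) t.val (h t.val) (h0 t.val) (h1 t.val)
    have hpD : (p : ℝ) * D1T p (τ t) (lawTp p y τ W b t.val)
        ≤ p * (2 * (2 : ℝ) ^ n * Real.sqrt (12 * p / ((m : ℝ) + 1))) :=
      mul_le_mul_of_nonneg_left hD hp.le
    linarith
  · have h1' : 1 ≤ Real.sqrt (12 * p / ((m : ℝ) + 1)) := by
      rw [Real.one_le_sqrt, one_le_div (by positivity)]
      exact_mod_cast not_lt.mp hmn
    have hM : (0 : ℝ) < (2 : ℝ) ^ n := pow_pos (by norm_num) n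
    have hp1 : (1 : ℝ) ≤ p := by exact_mod_cast NeZero.pos p
    have : (2 : ℝ) ^ n ≤ 4 * p * (2 : ℝ) ^ n * Real.sqrt (12 * p / ((m : ℝ) + 1)) := by
      have e : 4 * p * (2 : ℝ) ^ n * Real.sqrt (12 * p / ((m : ℝ) + 1))
          = (2 : ℝ) ^ n * (4 * (p * Real.sqrt (12 * p / ((m : ℝ) + 1)))) := by ring
      rw [e]
      have hps : (1 : ℝ) ≤ p * Real.sqrt (12 * p / ((m : ℝ) + 1)) := by
        have := mul_le_mul hp1 h1' zero_le_one hp.le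
        rwa [one_mul] at this
      nlinarith
    linarith

/-! ## §3 The backward weight system of a fibre -/

/-- the weight at time `n − k` of the final-counter fibre `β`: the indicator of `β` pulled back through the remaining steps
(averaged at free steps, shifted at frozen ones). -/
noncomputable def wB (β : ZMod p) : ℕ → ZMod p → ℝ
  | 0 => fun b' => if b' = β then 1 else 0
  | k + 1 =>
    if hk : k < n then
      (if (⟨n - 1 - k, by omega⟩ : Fin n) ∈ W then
        fun b' => wB β k (b' + (((b ⟨n - 1 - k, by omega⟩).toNat : ℕ) : ZMod p))
      else fun b' => (wB β k b' + wB β k (b' + 1)) / 2)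
    else wB β k

/-- the weight system indexed by time. -/
noncomputable def hB (β : ZMod p) (t : ℕ) : ZMod p → ℝ := wB p W b β (n - t)

omit [NeZero p] in
/-- CharDialSchedFibre helper `wB_nonneg` (decomp-qadv land package; see the module docstring). -/
theorem wB_nonneg (β : ZMod p) : ∀ k b', 0 ≤ wB p W b β k b'
  | 0, b' => by unfold wB; split_ifs <;> norm_num
  | k + 1, b' => by
    unfold wB
    by_cases hk : k < n
    · rw [dif_pos hk]
      split_ifs
      · exact wB_nonneg β k _
      · have h1 := wB_nonneg β k b'
        have h2 := wB_nonneg β k (b' + 1)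
        show 0 ≤ (wB p W b β k b' + wB p W b β k (b' + 1)) / 2
        linarith
    · rw [dif_neg hk]; exact wB_nonneg β k b'

omit [NeZero p] in
/-- CharDialSchedFibre helper `wB_le_one` (decomp-qadv land package; see the module docstring). -/
theorem wB_le_one (β : ZMod p) : ∀ k b', wB p W b β k b' ≤ 1
  | 0, b' => by unfold wB; split_ifs <;> norm_num
  | k + 1, b' => by
    unfold wB
    by_cases hk : k < n
    · rw [dif_pos hk]
      split_ifs
      · exact wB_le_one β k _
      · have h1 := wB_le_one β k b'
        have h2 := wB_le_one β k (b' + 1)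
        show (wB p W b β k b' + wB p W b β k (b' + 1)) / 2 ≤ 1
        linarith
    · rw [dif_neg hk]; exact wB_le_one β k b'

omit [NeZero p] in
/-- the successor case of `wB`, as an equation. -/
theorem wB_succ (β : ZMod p) (k : ℕ) (hk : k < n) :
    wB p W b β (k + 1) = if (⟨n - 1 - k, by omega⟩ : Fin n) ∈ W then
        fun b' => wB p W b β k (b' + (((b ⟨n - 1 - k, by omega⟩).toNat : ℕ) : ZMod p))
      else fun b' => (wB p W b β k b' + wB p W b β k (b' + 1)) / 2 := by
  rw [wB, dif_pos hk]

omit [NeZero p] in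
/-- the step relation of `hB` at a position `t < n`. -/
theorem hB_step (β : ZMod p) (t : Fin n) :
    hB p W b β t.val = if t ∈ W then fun b' => hB p W b β (t.val + 1) (b' + (((b t).toNat : ℕ) : ZMod p))
      else fun b' => (hB p W b β (t.val + 1) b' + hB p W b β (t.val + 1) (b' + 1)) / 2 := by
  have ht : t.val < n := t.isLt
  have ek : n - t.val = (n - t.val - 1) + 1 := by omega
  have ek' : n - (t.val + 1) = n - t.val - 1 := by omega
  have hk : n - t.val - 1 < n := by omega
  have et : (⟨n - 1 - (n - t.val - 1), by omega⟩ : Fin n) = t := Fin.ext (by simp only; omega)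
  unfold hB
  rw [ek, wB_succ p W b β _ hk, et, ek']

omit [NeZero p] in
/-- CharDialSchedFibre helper `hB_free` (decomp-qadv land package; see the module docstring). -/
theorem hB_free (β : ZMod p) (t : Fin n) (ht : t ∉ W) (b' : ZMod p) :
    hB p W b β t.val b' = (hB p W b β (t.val + 1) b' + hB p W b β (t.val + 1) (b' + 1)) / 2 := by
  rw [hB_step p W b β t, if_neg ht]

omit [NeZero p] in
/-- CharDialSchedFibre helper `hB_frozen` (decomp-qadv land package; see the module docstring). -/
theorem hB_frozen (β : ZMod p) (t : Fin n) (ht : t ∈ W) (b' : ZMod p) :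
    hB p W b β t.val b' = hB p W b β (t.val + 1) (b' + (((b t).toNat : ℕ) : ZMod p)) := by
  rw [hB_step p W b β t, if_pos ht]

omit [NeZero p] in
/-- CharDialSchedFibre helper `hB_final` (decomp-qadv land package; see the module docstring). -/
theorem hB_final (β : ZMod p) (b' : ZMod p) : hB p W b β n b' = if b' = β then 1 else 0 := by
  unfold hB; rw [Nat.sub_self]; rfl

/-- **THE FIBRE COUNT**: `#{u : W_n(u') = β ∧ final state ∈ L_{(κ,0)}} ≥ ⅓·#{u : W_n(u') = β} − 4p·2ⁿ·√(12p/(m+1))`. -/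
theorem card_memT_fib_ge (h3 : ¬ 3 ∣ p) (κ : ZMod 3) (β : ZMod p) :
    ((univ.filter fun u : Fin n → Bool => ctrN p (subcubeMerge W b u) n = β).card : ℝ) / 3
        - 4 * p * (2 : ℝ) ^ n * Real.sqrt (12 * p / ((n - W.card : ℕ) + 1))
      ≤ ((univ.filter fun u : Fin n → Bool => ctrN p (subcubeMerge W b u) n = β ∧
          mem (κ, none) (XTp p y τ (subcubeMerge W b u) n).1 (XTp p y τ (subcubeMerge W b u) n).2.1 = true).card : ℝ) := by
  have h := weighted_memT_ge p y τ W b h3 κ (hB p W b β) (fun t ht b' => hB_free p W b β t ht b')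
    (fun t ht b' => hB_frozen p W b β t ht b') (fun t b' => wB_nonneg p W b β _ _) (fun t b' => wB_le_one p W b β _ _)
  have e1 : ∑ u : Fin n → Bool, hB p W b β n (ctrN p (subcubeMerge W b u) n)
      = ((univ.filter fun u : Fin n → Bool => ctrN p (subcubeMerge W b u) n = β).card : ℝ) := by
    rw [card_eq_sum_ones, Nat.cast_sum, sum_filter]
    refine sum_congr rfl fun u _ => ?_
    rw [hB_final]
    split_ifs <;> simp
  have e2 : (∑ u : Fin n → Bool,
        if mem (κ, none) (XTp p y τ (subcubeMerge W b u) n).1 (XTp p y τ (subcubeMerge W b u) n).2.1 = true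
        then hB p W b β n (ctrN p (subcubeMerge W b u) n) else 0)
      = ((univ.filter fun u : Fin n → Bool => ctrN p (subcubeMerge W b u) n = β ∧
          mem (κ, none) (XTp p y τ (subcubeMerge W b u) n).1 (XTp p y τ (subcubeMerge W b u) n).2.1 = true).card : ℝ) := by
    simp only [hB_final]
    rw [card_eq_sum_ones, Nat.cast_sum, sum_filter]
    refine sum_congr rfl fun u _ => ?_
    by_cases hm : mem (κ, none) (XTp p y τ (subcubeMerge W b u) n).1 (XTp p y τ (subcubeMerge W b u) n).2.1 = true
    · by_cases hc : ctrN p (subcubeMerge W b u) n = β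
      · simp [hm, hc]
      · simp [hm, hc]
    · simp [hm]
  rw [e1, e2] at h
  exact h

end Process

end CounterLaw

/-! ## §4 The theorem -/

open CounterLaw in
/-- **R13⊕ ON SUBCUBES, PER FINAL-COUNTER FIBRE — PROVED (`3 ∤ p`).**  For every table source `y`, schedule `τ`, subcube
`{u_W = b_W}`, column `κ` and counter value `β`: among the merged inputs with `W_n ≡ β (p)`, the scheduled process ends outside
`L_{(κ,0)}` on at most `(2/3)·#{W_n ≡ β} + 4p·2ⁿ·√(12p/(n − |W| + 1))` of them. -/
theorem schedSubcubeFib_sharp (p : ℕ) (h3 : ¬ 3 ∣ p) (hp : 0 < p) {n : ℕ}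
    (y : Fin (n + 1) → (Fin n → Bool) → Bool) (τ : Fin n → Bool × Bool) (W : Finset (Fin n)) (b : Fin n → Bool)
    (κ : ZMod 3) (β : ZMod p) :
    ((univ.filter fun u : Fin n → Bool => ctrN p (AffBells22.subcubeMerge W b u) n = β ∧
        mem (κ, none) (XTp p y τ (AffBells22.subcubeMerge W b u) n).1
          (XTp p y τ (AffBells22.subcubeMerge W b u) n).2.1 = false).card : ℝ)
      ≤ 2 / 3 * ((univ.filter fun u : Fin n → Bool => ctrN p (AffBells22.subcubeMerge W b u) n = β).card : ℝ)
        + 4 * p * (2 : ℝ) ^ n * Real.sqrt (12 * p / ((n - W.card : ℕ) + 1)) := by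
  haveI : NeZero p := ⟨hp.ne'⟩
  have h := card_memT_fib_ge p y τ W b h3 κ β
  have hsplit : ((univ.filter fun u : Fin n → Bool => ctrN p (subcubeMerge W b u) n = β ∧
        mem (κ, none) (XTp p y τ (subcubeMerge W b u) n).1 (XTp p y τ (subcubeMerge W b u) n).2.1 = false).card : ℝ)
      + ((univ.filter fun u : Fin n → Bool => ctrN p (subcubeMerge W b u) n = β ∧
        mem (κ, none) (XTp p y τ (subcubeMerge W b u) n).1 (XTp p y τ (subcubeMerge W b u) n).2.1 = true).card : ℝ)
      = ((univ.filter fun u : Fin n → Bool => ctrN p (subcubeMerge W b u) n = β).card : ℝ) := by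
    rw [← Nat.cast_add, ← card_union_of_disjoint]
    · congr 2; ext u
      simp only [mem_union, mem_filter, mem_univ, true_and]
      constructor
      · rintro (⟨hc, _⟩ | ⟨hc, _⟩) <;> exact hc
      · intro hc
        cases mem (κ, none) (XTp p y τ (subcubeMerge W b u) n).1 (XTp p y τ (subcubeMerge W b u) n).2.1
        · exact Or.inl ⟨hc, rfl⟩
        · exact Or.inr ⟨hc, rfl⟩
    · rw [disjoint_filter]
      rintro u _ ⟨_, h1⟩ ⟨_, h2⟩
      rw [h1] at h2; exact Bool.false_ne_true h2
  linarith

end Summit.QuantumAdvantage.AdviceFreeQNC0
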